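import Summits.Parity.GeneralizedHardyLittlewood.Theses.LiouvilleMAD
import Summits.Parity.GeneralizedHardyLittlewood.Theorems.DilatedChowla.Negative.DilatedChowlaWelch
import Summits.Parity.GeneralizedHardyLittlewood.Theorems.LiouvilleMADFanDecorrelationStubFanFromLaws
import Summits.Parity.GeneralizedHardyLittlewood.Theorems.LiouvilleMADDivisorSwitch

/-!
# Disproof of `FanDecorrelation` (stmt-Parity-13318) — findings

Standing disprover's work file for the crux `LiouvilleMAD.FanDecorrelation` (route LiouvilleMAD,
rank 3; line `SketchIdeator1` = card `lag-window-normal-form`).  Notation: `Q = ⌊√M⌋ + 1`,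
`L z = λ(z.toNat)` (tree: `DilatedTableChowlaBlocks.L`), `S c n n' M = Σ_{m∈(M,2M]} λ(mn+c)λ(mn'+c)`
(tree: `DilatedChowlaMirrorDefs.S`), and the FAN SUM
`fan c n n' M k = Σ_{j∈[Q,2Q)} Σ_{(m,m')∈(M,2M]², m−m'=kj} λ(mn+c) λ(m'n'+c)` (`fanDecorrelation_iff`:
the crux is `|fan| ≤ C·M^{3/4+ϑ}`, some `ϑ < 1/4`, definitionally).

FINDINGS (cycle 1, 2026-08-16):
* (a) LOAD-BEARING.  `k ≠ 0` IS load-bearing, provably: `fan c n n' M 0 = Q · S c n n' M`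
  (`fan_zero`) and the Welch floor of the sibling crux (`exists_abs_S_ge_sqrt`: some `n ≠ n'` has
  `|S| ≥ √(M/2)`) give `|fan … 0| ≥ M/√2 > C·M^{3/4+ϑ}` — `fanDecorrelation_false_without_kNeZero`
  (LANDED as `Theorems/FanDecorrelation/Negative/FanDecorrelationKZero`, p99849).
  `c ≠ 0` and `n ≠ n'` remove NO diagonal from a fan (at `c = 0` the summand factorises,
  `fan 0 n n' M k = λ(n)λ(n')·fan₀ M k`, `fan_zero_shift`, so `c = 0` IS the `n = n'` autocorrelation
  fan `fan₀`; at `n = n'` every lag is still `≥ Q`) — hence neither is PROVABLY load-bearing — but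
  NUMERICALLY BOTH ARE (this seat, kit j016978 / j017230, §6): the autocorrelation fan is NOT Poisson.
  Mechanism = MAJOR-ARC POSITIVITY: `fan₀(M,k) = Σ_{j∈[Q,2Q)} C_M(kj)` (`C_M(h) = Σ_{m∼M} λ(m)λ(m−h)`) is a
  window of `(V_k − M)/2 = Σ_{j≥1} C_M(kj)`, where `V_k = Σ_{b mod k} (Σ_{m∼M, m≡b (k)} λ(m))²` is the
  VARIANCE OF `λ` IN APs mod `k`; in Fourier terms `fan₀(k) ≈ Q·Σ_{a mod k}(|S(a/k)|² − M)/…`, a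
  positive-semidefinite functional of the class sums.  And `V_k/M − 1` is empirically NOT Gaussian
  `N(0, 2/k)`: standardized `zV = (V_k/M−1)√(k/2)` has rms 1.47, 1.58, 1.70 and max 7.5, 11.8, 14.4 at
  `M = 1.6·10⁷, 6.4·10⁷, 2.56·10⁸`, the maximum at the SAME modulus `k = 2267` (prime) at all three
  scales (`δ_2267 = V/M − 1 = +0.43` at `M = 2.56·10⁸`), tails `P(zV > 3) ≈ 4–5 %`; correspondingly
  `max_k |fan₀|/M^{3/4} = 5.1, 5.3, 6.2, 8.2, 8.4` for `M = 10⁶ … 2.56·10⁸` (growth `≈ M^{0.09}`, zmax up to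
  11σ, corr(fan₀-z, zV) = +0.33…+0.37), against `3.0–4.3` FLAT, Poisson rms `0.995–1.002`, for the crux's
  own instance `(c,n,n') = (2,1,2)` on the same λ-table (reproducing the ideator's j015184 values
  exactly).  For `c ≠ 0 ∧ n ≠ n'` the major-arc term is a CROSS term `Σ_b S_b·S'_b` of two different
  class-sum vectors (same-modulus frame: a Jacobsthal sum, factor `≈ −1/d`), with no positivity —
  Poisson in every test (2780 dilation pairs in 9 families at `M = 11000`, j016978 part B; model
  instance to `2.56·10⁸`).  Information for the prover: the exclusions were copied from the coset crux,
  where they remove the diagonal class; in the fan they remove the λ-in-APs variance anomaly instead,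
  and any proof must distinguish the autocorrelation fan (empirically `≈ M^{3/4+0.09}` ≈
  `M^{3/4}(log M)^{1.5}` over `10⁶…2.56·10⁸`, still growing; probably logarithmic, §6) from the cross fan
  (`M^{3/4}`, flat).
* (b) NO PROPORTIONAL LAG (statement hygiene, = ideator B6): the two linear forms
  `m' ↦ (m'+h)n + c` and `m' ↦ m'n' + c` are proportional iff `n = t n'` and `h n = c(t−1)`, so the
  unique fully biased lag has `|h| ≤ |c| < Q ≤ kj` once `M > c²`: never inside the fan
  (`proportional_lag_small`).  Planted-lag strengthenings (uniformity in `c`, `c ≍ kQn`) bias ONE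
  lag `j`; the other `Q−1` lags are two-point Chowla sums whose cancellation against the planted
  `−M` cannot be excluded unconditionally — no provable kill even there.
* (c) NATURAL STRENGTHENINGS: exponent-tightness (`|fan| ≥ c₀ M^{3/4}` for some `k ≠ 0`) is NOT
  provable by positivity: unlike cosets (`T_j(n,n) = Σ_a A(a)² ≥ 0`, Fejér) the fan kernel
  `Σ_{j∈J} e(−kjθ)` is a Dirichlet kernel and `fan c n n M k` has no sign; the only rigorous floor
  found is JOINT with the cosets through DivisorSwitch (`Q·S = Σ_j T_j − Σ_{k≠0} fan_k`, Welch on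
  `S`): cosets and fans cannot BOTH be `≤ C·M^{1/2−ε}` (`mad_not_both_below_half`, §3, PROVED).
* (d) NUMERICS (ideator, kit j015184/j015548/j015613): `max_k |fan|/M^{3/4} ∈ [1.9,3.9]` flat over
  `M = 10⁴…1.6·10⁷`, Poisson rms `0.58–0.59`, no dilation dependence (`n ~ M, 2M` included),
  per-class unit fans Poisson.  This seat (§6): crux instance (2,1,2) Poisson to `M = 2.56·10⁸`
  (4.4 decades with the ideator's); 2780-pair dilation scan Gaussian; the EXCLUDED autocorrelation
  fan anomalous and growing (above); the Pólya/pole-at-1/2 caricature (`Σλχ ∼ (φ(d)/d)√x/L(1/2,χ)`,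
  real `χ`) is NOT the driver (PARI table of `L(1/2,χ_D)`, `|D| ≤ 17000`, j017113: the anomalous
  moduli have `L(1/2,χ_{−2267}) = 0.99`, `L(1/2,χ_{−3379}) = 1.97`; prediction/observation corr 0.06).
* WHY IT RESISTS: every hypothesis-drop except `k ≠ 0` and every natural strengthening reduces to an
  Ω-result for SIGNED two-point `λ`-correlations (`Σ λ(u)λ(u+h)` of size `≫ M^{1/2−ε}` along a
  sequence), and no such Ω-theorem is known — only one-point Landau `L(x) = Ω(√x)`; exact
  multiplicative coincidences live on lines `j = const ≤ |c|` (outside the fan) or on `≤ √M`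
  points; the Siegel caricature (`χ` mod `q ≤ √M` mimicking `λ`) is conditional and not even
  cheaply rigorous (TT2021 error `M log^{−1/10}` per lag swamps the `(Q/q)M` bias, ideator B7); and
  the one genuine arithmetic signal found numerically — the anomalous variance of `λ` in APs mod `k`
  — enters a fan only through autocorrelation positivity, which `c ≠ 0 ∧ n ≠ n'` switch off.

No `sorry` (the joint floor of §3 is closed: `mad_not_both_below_half`).
-/

noncomputable section

namespace Summit.Parity.GeneralizedHardyLittlewood.Cruxes.FanDecorrelation.Disproof

open Summit.Parity.GeneralizedHardyLittlewood.Theses.LiouvilleMAD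
open Summit.Parity.GeneralizedHardyLittlewood.Theorems.DilatedTableChowla.Negative
  (L L_mul_self_of_pos abs_L_le_one L_natCast L_natCast_mul L_nonpos_arg)
open Summit.Parity.GeneralizedHardyLittlewood.Theorems.DilatedChowla.Negative
  (S exists_abs_S_ge_sqrt abs_S_le)
open Finset Filter

/-! ## §0 The crux, factored -/

/-- The fan sum of the crux: `fan c n n' M k = Σ_{j∈[Q,2Q)} Σ_{(m,m')∈(M,2M]², m−m'=kj} λ(mn+c)λ(m'n'+c)`,
`Q = ⌊√M⌋+1`. -/
def fan (c : ℤ) (n n' M : ℕ) (k : ℤ) : ℝ :=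
  ∑ j ∈ Ico (Nat.sqrt M + 1) (2 * (Nat.sqrt M + 1)),
    ∑ p ∈ (Ioc M (2 * M) ×ˢ Ioc M (2 * M)).filter
        (fun p : ℕ × ℕ => (p.1 : ℤ) - p.2 = k * (j : ℤ)),
      L ((p.1 : ℤ) * n + c) * L ((p.2 : ℤ) * n' + c)

/-- READ-BACK: the crux is the uniform bound `|fan| ≤ C·M^{3/4+ϑ}` for some `ϑ < 1/4`
(definitional). -/
theorem fanDecorrelation_iff :
    FanDecorrelation ↔ ∀ c : ℤ, c ≠ 0 → ∃ ϑ : ℝ, ϑ < 1 / 4 ∧ ∃ C : ℝ, ∀ M n n' : ℕ, ∀ k : ℤ,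
      1 ≤ n → 1 ≤ n' → n ≠ n' → n ≤ 2 * M → n' ≤ 2 * M → k ≠ 0 →
        |fan c n n' M k| ≤ C * (M : ℝ) ^ (3 / 4 + ϑ) :=
  Iff.rfl

/-- `√M ≤ Q = ⌊√M⌋ + 1`. -/
theorem sqrt_le_natSqrt_add_one (M : ℕ) : Real.sqrt M ≤ (Nat.sqrt M : ℝ) + 1 := by
  have h : M < (Nat.sqrt M + 1) * (Nat.sqrt M + 1) := Nat.lt_succ_sqrt M
  have h' : (M : ℝ) ≤ ((Nat.sqrt M : ℝ) + 1) ^ 2 := by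
    have h'' : ((M : ℕ) : ℝ) < ((Nat.sqrt M + 1 : ℕ) : ℝ) * ((Nat.sqrt M + 1 : ℕ) : ℝ) := by
      exact_mod_cast h
    push_cast at h''
    nlinarith
  calc Real.sqrt M ≤ Real.sqrt (((Nat.sqrt M : ℝ) + 1) ^ 2) := Real.sqrt_le_sqrt h'
    _ = (Nat.sqrt M : ℝ) + 1 := Real.sqrt_sq (by positivity)

/-! ## §1 Load-bearing analysis -/

/-- At `k = 0` the lag filter is the diagonal of `(M,2M]²`. -/
theorem filter_lag_zero (M j : ℕ) :
    (Ioc M (2 * M) ×ˢ Ioc M (2 * M)).filter (fun p : ℕ × ℕ => (p.1 : ℤ) - p.2 = 0 * (j : ℤ)) =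
      (Ioc M (2 * M)).diag := by
  ext p
  simp only [mem_filter, mem_product, mem_diag, zero_mul, sub_eq_zero, Nat.cast_inj]
  constructor
  · rintro ⟨⟨h1, _⟩, h⟩
    exact ⟨h1, h⟩
  · rintro ⟨h1, h⟩
    exact ⟨⟨h1, h ▸ h1⟩, h⟩

/-- **The `k = 0` fan is `Q` copies of the dilated Chowla sum**: `fan c n n' M 0 = Q · S c n n' M`. -/
theorem fan_zero (c : ℤ) (n n' M : ℕ) :
    fan c n n' M 0 = ((Nat.sqrt M : ℝ) + 1) * S c n n' M := by
  unfold fan S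
  have hin : ∀ j ∈ Ico (Nat.sqrt M + 1) (2 * (Nat.sqrt M + 1)),
      ∑ p ∈ (Ioc M (2 * M) ×ˢ Ioc M (2 * M)).filter
          (fun p : ℕ × ℕ => (p.1 : ℤ) - p.2 = 0 * (j : ℤ)),
        L ((p.1 : ℤ) * n + c) * L ((p.2 : ℤ) * n' + c) =
      ∑ m ∈ Ioc M (2 * M), L ((m : ℤ) * n + c) * L ((m : ℤ) * n' + c) := by
    intro j _
    rw [filter_lag_zero, sum_diag]
  have hcard : (Ico (Nat.sqrt M + 1) (2 * (Nat.sqrt M + 1))).card = Nat.sqrt M + 1 := by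
    rw [Nat.card_Ico]; omega
  rw [sum_congr rfl hin, sum_const, hcard, nsmul_eq_mul]
  push_cast
  ring

/-- The crux with the exclusion `k ≠ 0` DROPPED (everything else verbatim). -/
def FanDecorrelationWithoutKNeZero : Prop :=
  ∀ c : ℤ, c ≠ 0 → ∃ ϑ : ℝ, ϑ < 1 / 4 ∧ ∃ C : ℝ, ∀ M n n' : ℕ, ∀ k : ℤ,
    1 ≤ n → 1 ≤ n' → n ≠ n' → n ≤ 2 * M → n' ≤ 2 * M →
      |fan c n n' M k| ≤ C * (M : ℝ) ^ (3 / 4 + ϑ)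

/-- The original crux is the `k ≠ 0` restriction of the dropped-hypothesis version. -/
theorem fanDecorrelation_of_without (h : FanDecorrelationWithoutKNeZero) : FanDecorrelation := by
  intro c hc
  obtain ⟨ϑ, hϑ, C, hC⟩ := h c hc
  exact ⟨ϑ, hϑ, C, fun M n n' k hn hn' hne hn2 hn2' _ => hC M n n' k hn hn' hne hn2 hn2'⟩

/-- **`k ≠ 0` is load-bearing** ("any proof must use `k ≠ 0`"): with `k = 0` allowed the crux is
false.  Witness `c = 1`, `k = 0`: `fan 1 n n' M 0 = Q·S 1 n n' M` (`fan_zero`), and by the Welch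
floor of the sibling crux (`exists_abs_S_ge_sqrt`) every `M ≥ 2` has a pair `1 ≤ n ≠ n' ≤ 2M` with
`|S 1 n n' M| ≥ √(M/2)`, so `|fan| ≥ Q√(M/2) ≥ M/√2`, while `C·M^{3/4+ϑ} ≤ |C|·M^{a}`,
`a = max(3/4+ϑ, 1/2) < 1` — impossible for `M^{1−a} > √2|C|`. [folklore] -/
theorem fanDecorrelation_false_without_kNeZero : ¬ FanDecorrelationWithoutKNeZero := by
  intro h
  obtain ⟨ϑ, hϑ, C, hC⟩ := h 1 one_ne_zero
  set a : ℝ := max (3 / 4 + ϑ) (1 / 2) with ha_def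
  have ha1 : a < 1 := max_lt (by linarith) (by norm_num)
  have hε : 0 < 1 - a := by linarith
  have ht : Tendsto (fun M : ℕ => (M : ℝ) ^ (1 - a)) atTop atTop :=
    (tendsto_rpow_atTop hε).comp tendsto_natCast_atTop_atTop
  obtain ⟨M, hM2, hMC⟩ :=
    ((eventually_ge_atTop 2).and (ht.eventually_gt_atTop (Real.sqrt 2 * |C|))).exists
  have hM2' : (2 : ℝ) ≤ M := by exact_mod_cast hM2
  have hx : (0 : ℝ) < M := by linarith
  have hx1 : (1 : ℝ) ≤ M := by linarith
  have habs : (|(1 : ℤ)| : ℝ) < M := by norm_num; linarith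
  obtain ⟨n, n', hn, hn', hne, hn2, hn2', hle⟩ := exists_abs_S_ge_sqrt 1 M habs
  have key := hC M n n' 0 hn hn' hne hn2 hn2'
  rw [fan_zero, abs_mul, abs_of_pos (by positivity : (0 : ℝ) < (Nat.sqrt M : ℝ) + 1)] at key
  -- lower bound `M/√2 ≤ Q·|S|`
  have hlow : Real.sqrt M * Real.sqrt ((M : ℝ) / 2) ≤ ((Nat.sqrt M : ℝ) + 1) * |S 1 n n' M| :=
    mul_le_mul (sqrt_le_natSqrt_add_one M) hle (Real.sqrt_nonneg _) (by positivity)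
  have hprod : Real.sqrt M * Real.sqrt ((M : ℝ) / 2) = (M : ℝ) / Real.sqrt 2 := by
    rw [← Real.sqrt_mul hx.le, show (M : ℝ) * (M / 2) = M ^ 2 / 2 by ring,
      Real.sqrt_div (by positivity) 2, Real.sqrt_sq hx.le]
  -- upper bound `C·M^{3/4+ϑ} ≤ |C|·M^a`
  have hup : C * (M : ℝ) ^ (3 / 4 + ϑ) ≤ |C| * (M : ℝ) ^ a :=
    calc C * (M : ℝ) ^ (3 / 4 + ϑ) ≤ |C| * (M : ℝ) ^ (3 / 4 + ϑ) :=
          mul_le_mul_of_nonneg_right (le_abs_self C) (by positivity)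
      _ ≤ |C| * (M : ℝ) ^ a :=
          mul_le_mul_of_nonneg_left
            (Real.rpow_le_rpow_of_exponent_le hx1 (le_max_left _ _)) (abs_nonneg C)
  have h1 : (M : ℝ) / Real.sqrt 2 ≤ |C| * (M : ℝ) ^ a := by
    rw [← hprod]; exact hlow.trans (key.trans hup)
  have hsplit : (M : ℝ) = (M : ℝ) ^ a * (M : ℝ) ^ (1 - a) := by
    rw [← Real.rpow_add hx, show a + (1 - a) = 1 by ring, Real.rpow_one]
  have hpos : (0 : ℝ) < (M : ℝ) ^ a := Real.rpow_pos_of_pos hx a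
  have h1' : (M : ℝ) ^ a * (M : ℝ) ^ (1 - a) ≤ (M : ℝ) ^ a * (Real.sqrt 2 * |C|) :=
    calc (M : ℝ) ^ a * (M : ℝ) ^ (1 - a) = (M : ℝ) := hsplit.symm
      _ ≤ |C| * (M : ℝ) ^ a * Real.sqrt 2 := (div_le_iff₀ (Real.sqrt_pos.mpr two_pos)).mp h1
      _ = (M : ℝ) ^ a * (Real.sqrt 2 * |C|) := by ring
  have h2 : (M : ℝ) ^ (1 - a) ≤ Real.sqrt 2 * |C| := le_of_mul_le_mul_left h1' hpos
  linarith

/-- The pure-`λ` window sum `fan₀ M k = Σ_{j∈[Q,2Q)} Σ_{(m,m')∈(M,2M]², m−m'=kj} λ(m)λ(m')`. -/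
def fan₀ (M : ℕ) (k : ℤ) : ℝ :=
  ∑ j ∈ Ico (Nat.sqrt M + 1) (2 * (Nat.sqrt M + 1)),
    ∑ p ∈ (Ioc M (2 * M) ×ˢ Ioc M (2 * M)).filter
        (fun p : ℕ × ℕ => (p.1 : ℤ) - p.2 = k * (j : ℤ)),
      L (p.1 : ℤ) * L (p.2 : ℤ)

/-- **At `c = 0` the summand factorises** by complete multiplicativity:
`fan 0 n n' M k = λ(n)λ(n')·fan₀ M k`, the AUTOCORRELATION fan of `λ` itself (= the `n = n'` case).
So `c = 0` removes no diagonal — but `fan₀` is NOT the crux's model object: the crux instance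
`(c,n,n') = (2,1,2)` is `−Σ_j Σ_u λ(u)λ(u+kj+1)` (lags `kj+1`, a cross term at the major arcs), while
`fan₀` (lags `kj`) is a window of the excess AP-variance `(V_k − M)/2` and is numerically anomalous
(header (a), §6).  Dropping `c ≠ 0` therefore adds `|fan₀ M k| ≤ C·M^{3/4+ϑ}`: numerically
`max_k |fan₀|/M^{3/4}` grows `5.1 → 8.4` over `M = 10⁶…2.56·10⁸` (`≈ M^{0.09}` or `(log M)^{1.5}`, not
separable on 2.4 decades); under the multiplicative-chaos reading (§6) the growth is logarithmic and the
variant stays TRUE for every `ϑ > 0` — so `c ≠ 0` is load-bearing for constants and METHODS (nothing that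
treats the autocorrelation fan like the cross fan is sharp), not demonstrably for truth. -/
theorem fan_zero_shift (n n' M : ℕ) (k : ℤ) : fan 0 n n' M k = L n * L n' * fan₀ M k := by
  unfold fan fan₀
  rw [mul_sum]
  refine sum_congr rfl fun j _ => ?_
  rw [mul_sum]
  refine sum_congr rfl fun p _ => ?_
  rw [add_zero, add_zero, L_natCast_mul, L_natCast_mul]
  ring

/-- Trivial bound `|fan| ≤ Q·M²` (tree: `FanFromLaws.abs_fanSum_le`, restated for `fan`). -/
theorem abs_fan_le (c : ℤ) (n n' M : ℕ) (k : ℤ) :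
    |fan c n n' M k| ≤ ((Nat.sqrt M + 1 : ℕ) : ℝ) * (M : ℝ) ^ 2 :=
  Summit.Parity.GeneralizedHardyLittlewood.Theorems.FanDecorrelation.FanFromLaws.abs_fanSum_le
    c n n' M k

/-- Fans are empty for `k ≥ 2Q` (tree: `FanFromLaws.fanSum_eq_zero_of_le`). -/
theorem fan_eq_zero_of_le (c : ℤ) (n n' M : ℕ) (k : ℤ) (hk : (2 * (Nat.sqrt M + 1) : ℤ) ≤ k) :
    fan c n n' M k = 0 :=
  Summit.Parity.GeneralizedHardyLittlewood.Theorems.FanDecorrelation.FanFromLaws.fanSum_eq_zero_of_le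
    c n n' M k hk

/-! ## §2 Statement hygiene: no proportional lag inside the fan -/

/-- **No fully biased lag in the fan.**  If the two linear forms `m' ↦ (m'+h)·n + c` and
`m' ↦ m'·n' + c` are proportional with ratio `t` (the only way `λ((m'+h)n+c)·λ(m'n'+c) = λ(t)` for
ALL `m'`), i.e. `n = t·n'` and `h·n = c·(t−1)`, then `|h| ≤ |c|`: for `M > c²` such a lag is `< Q`
and never of the form `k·j`, `j ∈ [Q,2Q)`, `k ≠ 0`. [folklore] -/
theorem proportional_lag_small {n n' t h c : ℤ} (hn' : 1 ≤ n') (ht : n = t * n') (hn : 1 ≤ n)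
    (hprop : h * n = c * (t - 1)) : |h| ≤ |c| := by
  have ht1 : 1 ≤ t := by nlinarith
  have key : |h| * n = |c| * (t - 1) := by
    have := congrArg abs hprop
    rwa [abs_mul, abs_mul, abs_of_pos (by linarith : (0 : ℤ) < n),
      abs_of_nonneg (by linarith : (0 : ℤ) ≤ t - 1)] at this
  have hn_ge : t ≤ n := by nlinarith
  nlinarith [abs_nonneg h, abs_nonneg c]

/-! ## §3 Joint floor with the cosets (DivisorSwitch + Welch) -/

/-- The coset sum of the sibling crux in the same notation:
`coset c n n' M j = Σ_{(m,m')∈(M,2M]², m ≡ m' (mod j)} λ(mn+c)λ(m'n'+c)`. -/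
def coset (c : ℤ) (n n' M j : ℕ) : ℝ :=
  ∑ p ∈ (Ioc M (2 * M) ×ˢ Ioc M (2 * M)).filter (fun p : ℕ × ℕ => p.1 ≡ p.2 [MOD j]),
    L ((p.1 : ℤ) * n + c) * L ((p.2 : ℤ) * n' + c)

/-- DivisorSwitch (tree theorem `DivisorSwitch_proof`) specialised to the crux's summand and
`Q = ⌊√M⌋+1`: `Q·S + Σ_{0<|k|≤M} fan_k = Σ_{j∈[Q,2Q)} coset_j`. -/
theorem divisorSwitch_fan (c : ℤ) (n n' M : ℕ) :
    ((Nat.sqrt M : ℝ) + 1) * S c n n' M + ∑ k ∈ (Icc (-(M : ℤ)) M).erase 0, fan c n n' M k =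
      ∑ j ∈ Ico (Nat.sqrt M + 1) (2 * (Nat.sqrt M + 1)), coset c n n' M j := by
  have h := Summit.Parity.GeneralizedHardyLittlewood.Theorems.DivisorSwitch_proof
    (fun m m' => L ((m : ℤ) * n + c) * L ((m' : ℤ) * n' + c)) M (Nat.sqrt M + 1)
  have hcard : (Ico (Nat.sqrt M + 1) (2 * (Nat.sqrt M + 1))).card = Nat.sqrt M + 1 := by
    rw [Nat.card_Ico]; omega
  rw [hcard] at h
  unfold fan coset S
  push_cast at h
  exact h

/-! ## §4 Line `SketchIdeator1` (stubs `stub_lagWindowLaw`, `stub_fanWindowCosetLaw`) -/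

/-
TARGETS: none this cycle (`stuck_stubs = []`; stubs 1 `stub_residueSplitting` and 4
`stub_fanFromLaws` are LANDED: Theorems/LiouvilleMADFanDecorrelationStub{ResidueSplitting,FanFromLaws}).

Stub 2 `stub_lagWindowLaw` (per-class unit fans `≤ C·M^{1−κ}/k`, `1 ≤ k ≤ M^{3/8}`, `r < k`):
* its `k = 1, r = 0` instance is the crux at `k = 1` verbatim (box `((M−0)/1,(2M−0)/1] = (M,2M]`,
  window `y − y' ∈ [Q,2Q)`), so it inherits every obstruction above; no cheaper surface.
* random model: unit fan has `≈ Q·M/k` terms, size `M^{3/4}k^{−1/2}`; the bound `M^{1−κ}/k` needs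
  `k ≤ M^{1/2−2κ}`, i.e. `κ ≤ 1/16` at `k = M^{3/8}`; the union bound over the `≍ M^{2.75}` tuples
  `(n,n',k,r)` per scale costs only `√(5.5 log M)`: consistent for every `κ < 1/16`.  Numerically
  per-class Poisson, no class alignment (ideator kit j015548).
* corners: `k = 0` excluded by `1 ≤ k` (else `(M−r)/0 = 0`, empty box — harmless anyway);
  `r < k ≤ M^{3/8} < M` so `M − r` never truncates; arguments `((ky+r)n + c) ≥ M+1+c > 0` for
  `M ≥ |c|`; proportional lags need `|h| ≤ |c|` (§2) but lags are `≥ Q`.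
* dropping `n ≠ n'` or `c ≠ 0`: as for the crux, no diagonal appears (lags `≥ Q ≥ 1`): not
  load-bearing as far as any rigorous argument can see.
Stub 3 `stub_fanWindowCosetLaw` (`Σ_{r<q}` unit fans `≤ C·M^{3/4+ϑ}`, `M^{3/8} ≤ q < 2Q`): by the
landed residue splitting this IS the crux restricted to `k = q ∈ [M^{3/8}, 2Q)`; same surface.
JOINT SUFFICIENCY: kernel-checked (`stub_fanFromLaws`, landed) — no gap to exploit.
VERDICT for the lead: no stub is cheaply refutable; the line's open content = the crux split by
`k`-regime, with stub 2 strengthened only by forbidding inter-class cancellation (safe iff `κ < 1/16`).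
NUMERICAL WARNING for both laws (header (a), §6): the unit fans / class-summed fans of the laws are CROSS
fans of two different rows (`n ≠ n'`) — Poisson in every test — but the AUTOCORRELATION fan of one row is
not (`≈ M^{3/4+0.09}`, driven by the anomalous variance of `λ` in APs); so any proof step that bounds a
law by a functional of ONE row (Cauchy–Schwarz between the rows, large sieve / spectral measure of a
single row, variance of `λ(n·+c)` in APs) inherits the autocorrelation anomaly on top of the Parseval
wall (ideator B1) and cannot deliver `κ` close to `1/16` resp. `ϑ` close to `0`.
-/

/-- Fans are empty as soon as `|k| ≥ 2Q` (both signs): a pair `(m,m') ∈ (M,2M]²` has `|m − m'| < M < Q²`,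
while `|k j| ≥ 2Q·Q`. [folklore] -/
theorem fan_eq_zero_of_abs_ge (c : ℤ) (n n' M : ℕ) (k : ℤ)
    (hk : (2 * (Nat.sqrt M + 1) : ℤ) ≤ |k|) : fan c n n' M k = 0 := by
  unfold fan
  refine sum_eq_zero fun j hj => sum_eq_zero fun p hp => ?_
  exfalso
  rw [mem_filter, mem_product, mem_Ioc, mem_Ioc] at hp
  rw [mem_Ico] at hj
  obtain ⟨⟨⟨h1, h2⟩, ⟨h3, h4⟩⟩, heq⟩ := hp
  have hQ : M < (Nat.sqrt M + 1) * (Nat.sqrt M + 1) := Nat.lt_succ_sqrt M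
  have hQ' : (M : ℤ) < ((Nat.sqrt M + 1 : ℕ) : ℤ) * ((Nat.sqrt M + 1 : ℕ) : ℤ) := by exact_mod_cast hQ
  have hj' : ((Nat.sqrt M + 1 : ℕ) : ℤ) ≤ (j : ℤ) := by exact_mod_cast hj.1
  have hk' : 2 * ((Nat.sqrt M + 1 : ℕ) : ℤ) ≤ |k| := by push_cast; exact_mod_cast hk
  have hkj : 2 * ((Nat.sqrt M + 1 : ℕ) : ℤ) * ((Nat.sqrt M + 1 : ℕ) : ℤ) ≤ |k| * (j : ℤ) :=
    mul_le_mul hk' hj' (by positivity) (abs_nonneg k)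
  have habs : |(p.1 : ℤ) - p.2| = |k| * (j : ℤ) := by
    rw [heq, abs_mul, abs_of_nonneg (by positivity : (0 : ℤ) ≤ (j : ℤ))]
  have h1' : (M : ℤ) + 1 ≤ (p.1 : ℤ) := by exact_mod_cast h1
  have h2' : (p.1 : ℤ) ≤ 2 * (M : ℤ) := by exact_mod_cast h2
  have h3' : (M : ℤ) + 1 ≤ (p.2 : ℤ) := by exact_mod_cast h3
  have h4' : (p.2 : ℤ) ≤ 2 * (M : ℤ) := by exact_mod_cast h4
  have hlt : |(p.1 : ℤ) - p.2| < M := abs_sub_lt_iff.mpr ⟨by linarith, by linarith⟩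
  nlinarith

/-- **Joint floor at exponent 1/2 (MAD is not a pure square-root phenomenon).**  For every exponent
`e < 1/2` and every constant `C` there are a scale `M` and dilations `1 ≤ n ≠ n' ≤ 2M` (shift `c = 1`)
at which EITHER some coset sum `T_j`, `j ∈ [Q,2Q)`, OR some fan sum `R_k`, `k ≠ 0`, exceeds `C·M^e`:
the two decorrelation cruxes `CosetDecorrelation`, `FanDecorrelation` cannot both hold with exponent
below `1/2`.  Proof: DivisorSwitch (`divisorSwitch_fan`) gives `Q·S = Σ_j T_j − Σ_{0<|k|≤M} R_k`; fans
vanish for `|k| ≥ 2Q` (`fan_eq_zero_of_abs_ge`), so at most `Q + (4Q−1) ≤ 5Q` terms survive, each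
`≤ C·M^e`; the Welch floor (`exists_abs_S_ge_sqrt`) supplies `n ≠ n'` with `|S| ≥ √(M/2)`, whence
`√(M/2) ≤ 5C·M^e`, false for `M^{1/2−e} > 5√2|C|`. [folklore] -/
theorem mad_not_both_below_half (e : ℝ) (he : e < 1 / 2) (C : ℝ) :
    ∃ M n n' : ℕ, 1 ≤ n ∧ 1 ≤ n' ∧ n ≠ n' ∧ n ≤ 2 * M ∧ n' ≤ 2 * M ∧
      ((∃ j : ℕ, Nat.sqrt M + 1 ≤ j ∧ j < 2 * (Nat.sqrt M + 1) ∧ C * (M : ℝ) ^ e < |coset 1 n n' M j|)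
        ∨ ∃ k : ℤ, k ≠ 0 ∧ C * (M : ℝ) ^ e < |fan 1 n n' M k|) := by
  by_contra hcon
  push Not at hcon
  -- choose the scale
  have hε : 0 < 1 / 2 - e := by linarith
  have ht : Tendsto (fun M : ℕ => (M : ℝ) ^ (1 / 2 - e)) atTop atTop :=
    (tendsto_rpow_atTop hε).comp tendsto_natCast_atTop_atTop
  obtain ⟨M, hM2, hMC⟩ :=
    ((eventually_ge_atTop 2).and (ht.eventually_gt_atTop (5 * Real.sqrt 2 * |C|))).exists
  have hM2' : (2 : ℝ) ≤ M := by exact_mod_cast hM2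
  have hx : (0 : ℝ) < M := by linarith
  have habs : (|(1 : ℤ)| : ℝ) < M := by norm_num; linarith
  -- the Welch pair
  obtain ⟨n, n', hn, hn', hne, hn2, hn2', hle⟩ := exists_abs_S_ge_sqrt 1 M habs
  obtain ⟨hcos, hfan⟩ := hcon M n n' hn hn' hne hn2 hn2'
  set Q' : ℕ := Nat.sqrt M + 1 with hQ'_def
  set B : ℝ := C * (M : ℝ) ^ e with hB_def
  have hQ'1 : 1 ≤ Q' := by omega
  have hB : 0 ≤ B := le_trans (abs_nonneg _) (hcos Q' le_rfl (by omega))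
  -- cosets: `Σ_j |T_j| ≤ Q'·B`
  have hcos_sum : ∑ j ∈ Ico Q' (2 * Q'), |coset 1 n n' M j| ≤ (Q' : ℝ) * B := by
    have h1 : ∑ j ∈ Ico Q' (2 * Q'), |coset 1 n n' M j| ≤ ∑ _j ∈ Ico Q' (2 * Q'), B :=
      sum_le_sum fun j hj => by
        rw [mem_Ico] at hj
        exact hcos j hj.1 hj.2
    have hcard : (Ico Q' (2 * Q')).card = Q' := by rw [Nat.card_Ico]; omega
    rwa [sum_const, hcard, nsmul_eq_mul] at h1
  -- fans: `Σ_{0<|k|≤M} |R_k| ≤ 4Q'·B`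
  have hfan_sum : ∑ k ∈ (Icc (-(M : ℤ)) M).erase 0, |fan 1 n n' M k| ≤ 4 * (Q' : ℝ) * B := by
    have h1 : ∑ k ∈ (Icc (-(M : ℤ)) M).erase 0, |fan 1 n n' M k| ≤
        ∑ k ∈ (Icc (-(M : ℤ)) M).erase 0, (if |k| < 2 * (Q' : ℤ) then B else 0) := by
      refine sum_le_sum fun k hk => ?_
      split_ifs with h
      · exact hfan k (ne_of_mem_erase hk)
      · rw [fan_eq_zero_of_abs_ge 1 n n' M k (by exact_mod_cast not_lt.mp h), abs_zero]
    have h2 : ∑ k ∈ (Icc (-(M : ℤ)) M).erase 0, (if |k| < 2 * (Q' : ℤ) then B else 0) =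
        (((Icc (-(M : ℤ)) M).erase 0).filter (fun k : ℤ => |k| < 2 * (Q' : ℤ))).card * B := by
      rw [← sum_filter, sum_const, nsmul_eq_mul]
    have h3 : (((Icc (-(M : ℤ)) M).erase 0).filter (fun k : ℤ => |k| < 2 * (Q' : ℤ))).card ≤
        (Ioo (-(2 * (Q' : ℤ))) (2 * (Q' : ℤ))).card := by
      refine card_le_card fun k hk => ?_
      rw [mem_filter] at hk
      rw [mem_Ioo]
      exact abs_lt.mp hk.2
    have h4 : ((Ioo (-(2 * (Q' : ℤ))) (2 * (Q' : ℤ))).card : ℝ) ≤ 4 * (Q' : ℝ) := by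
      rw [Int.card_Ioo]
      have : (2 * (Q' : ℤ) - -(2 * (Q' : ℤ)) - 1).toNat = 4 * Q' - 1 := by omega
      rw [this]
      have h5 : ((4 * Q' - 1 : ℕ) : ℝ) ≤ ((4 * Q' : ℕ) : ℝ) := by exact_mod_cast Nat.sub_le _ _
      push_cast at h5
      exact h5
    have h3' : ((((Icc (-(M : ℤ)) M).erase 0).filter (fun k : ℤ => |k| < 2 * (Q' : ℤ))).card : ℝ) ≤
        4 * (Q' : ℝ) := le_trans (by exact_mod_cast h3) h4
    calc ∑ k ∈ (Icc (-(M : ℤ)) M).erase 0, |fan 1 n n' M k|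
        ≤ (((Icc (-(M : ℤ)) M).erase 0).filter (fun k : ℤ => |k| < 2 * (Q' : ℤ))).card * B :=
          h1.trans h2.le
      _ ≤ 4 * (Q' : ℝ) * B := mul_le_mul_of_nonneg_right h3' hB
  -- DivisorSwitch: `Q'·|S| ≤ Σ|T_j| + Σ|R_k| ≤ 5Q'·B`
  have hDS := divisorSwitch_fan 1 n n' M
  have hQ'R : ((Nat.sqrt M : ℝ) + 1) = (Q' : ℝ) := by rw [hQ'_def]; push_cast; ring
  rw [hQ'R] at hDS
  have hQS : (Q' : ℝ) * |S 1 n n' M| ≤ 5 * (Q' : ℝ) * B := by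
    have h1 : (Q' : ℝ) * S 1 n n' M =
        ∑ j ∈ Ico Q' (2 * Q'), coset 1 n n' M j - ∑ k ∈ (Icc (-(M : ℤ)) M).erase 0, fan 1 n n' M k := by
      rw [← hDS]; ring
    calc (Q' : ℝ) * |S 1 n n' M| = |(Q' : ℝ) * S 1 n n' M| := by
          rw [abs_mul, abs_of_nonneg (by positivity : (0 : ℝ) ≤ (Q' : ℝ))]
      _ ≤ |∑ j ∈ Ico Q' (2 * Q'), coset 1 n n' M j| +
            |∑ k ∈ (Icc (-(M : ℤ)) M).erase 0, fan 1 n n' M k| := by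
          rw [h1]; exact abs_sub _ _
      _ ≤ ∑ j ∈ Ico Q' (2 * Q'), |coset 1 n n' M j| +
            ∑ k ∈ (Icc (-(M : ℤ)) M).erase 0, |fan 1 n n' M k| :=
          add_le_add (abs_sum_le_sum_abs _ _) (abs_sum_le_sum_abs _ _)
      _ ≤ (Q' : ℝ) * B + 4 * (Q' : ℝ) * B := add_le_add hcos_sum hfan_sum
      _ = 5 * (Q' : ℝ) * B := by ring
  have hQ'pos : (0 : ℝ) < Q' := by exact_mod_cast hQ'1
  have hS : |S 1 n n' M| ≤ 5 * B := by
    have : (Q' : ℝ) * |S 1 n n' M| ≤ (Q' : ℝ) * (5 * B) := by linarith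
    exact le_of_mul_le_mul_left this hQ'pos
  -- `√(M/2) ≤ 5 C M^e ≤ 5|C| M^e`, against `M^{1/2-e} > 5√2|C|`
  have key : Real.sqrt ((M : ℝ) / 2) ≤ 5 * |C| * (M : ℝ) ^ e := by
    calc Real.sqrt ((M : ℝ) / 2) ≤ 5 * B := hle.trans hS
      _ = 5 * C * (M : ℝ) ^ e := by rw [hB_def]; ring
      _ ≤ 5 * |C| * (M : ℝ) ^ e := by
          have := le_abs_self C
          have h0 : (0 : ℝ) ≤ (M : ℝ) ^ e := by positivity
          nlinarith
  rw [Real.sqrt_div' _ zero_le_two, Real.sqrt_eq_rpow (M : ℝ),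
    div_le_iff₀ (Real.sqrt_pos.mpr zero_lt_two)] at key
  have hMC' : 5 * Real.sqrt 2 * |C| < (M : ℝ) ^ (1 / 2 : ℝ) / (M : ℝ) ^ e := by
    rw [← Real.rpow_sub hx]
    exact hMC
  rw [lt_div_iff₀ (Real.rpow_pos_of_pos hx _)] at hMC'
  nlinarith [Real.sqrt_nonneg 2, abs_nonneg C, Real.rpow_pos_of_pos hx e,
    Real.sq_sqrt (show (0:ℝ) ≤ 2 by norm_num)]

/-! ## §6 Numerical record (this seat; scripts `numerics/fan_ext.py`, `numerics/fan0_vs_L.py`, `numerics/job3/main.py`)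

All from ONE Liouville table (parity sieve, `L(10⁶) = −530` check), FFT cross-correlations validated
against the Lean definition by brute force on 6 small cases (general dilations, both signs of `k`).
* j016978 PART A — crux instance `(2,1,2)`, all `k`: `max_k|R_k|/M^{3/4} = 3.05, 3.46, 4.29, 3.70, 3.39`
  at `M = 10⁶, 1.6·10⁷, 6.4·10⁷, 1.28·10⁸, 2.56·10⁸` (ideator's `3.049@32`, `3.460@76` reproduced exactly);
  Poisson rms `0.995–0.999`; zmax `3.5–4.6` vs Gaussian `3.9–4.6`.  FLAT: `ϑ = 0⁺` numerically.
* j016978 PART A — autocorrelation fan `fan₀` (= `c = 0` = `n = n'`, EXCLUDED): `5.08, 5.28, 6.17,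
  8.19, 8.40` (growth exponent `≈ 0.09`), Poisson-rms ratio `1.15, 1.31, 1.38, 1.41, 1.44`, zmax
  `5.2, 5.9, 7.8, 11.0, 10.2`, argmax `k = 3379` at both `1.28·10⁸` and `2.56·10⁸`.
* j016978 PART B — `M = 11000`, `c ∈ {1,2,−1,6}`, 2780 pairs `(n,n')` (all `n<n'≤40`; `(n,2n)`;
  `(n,n+1)`; `(1,n')`; `(a²,b²)`; random) + 600 iid controls: standardized extremes per pair
  `zmax` quantiles λ `[2.95, 3.53, 4.10, 4.99]` = iid `[2.98, 3.49, 4.08, 4.52]`; global max `4.99`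
  below the Gaussian prediction `5.15`; Poisson rms `0.99–1.00` in every family.
* j017113 (PARI) — `L(1/2,χ_D)`, all fundamental `|D| ≤ 17000` (10337 values; smallest
  `L(1/2,χ_{14693}) = 0.0018`); the anomalous `k` have ordinary values — pole mechanism excluded.
* j017230 — per-`k` arrays; `zV = (V_k/M − 1)√(k/2)`: rms `1.47, 1.58, 1.70`, max `7.5 (k=1091),
  11.8 (k=2267), 14.4 (k=2267)` at `M = 1.6·10⁷, 6.4·10⁷, 2.56·10⁸`; `corr(fan₀-z, zV) = +0.33…+0.37`;
  mean `V_k/M − 1` for `k < 10` is `−0.20, −0.36, −0.47` (sub-Poisson long sums, Harper-type), `≈ 0`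
  for `k ≥ 10³`; `rms(zV)² − 1 = 1.16, 1.50, 1.89` is LINEAR in `log M` (slope ≈ 0.26).  READING:
  `V_k = φ(k)⁻¹Σ_χ|B_χ|²`, `B_χ = Σ_{m∼M} λχ(m)` partial sums of the multiplicative functions `λχ`, whose
  fourth moment is `≍ M² log M` (Heap–Lindqvist doi:10.1093/qmath/haw026; Harper, Moments of random
  multiplicative functions I/II doi:10.1017/fmp.2019.7, doi:10.2140/ant.2019.13.2277; large fluctuations
  doi:10.1093/imrn/rnab299) instead of the Gaussian `2M²`: heavy-tailed
  (multiplicative chaos), with a level set by how well `χ(p)` mimics `λ(p) = −1` at small primes, hence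
  persistent in `k` and slowly drifting in `log M` — all as observed.  The pole-at-1/2 and low-zero
  caricatures predict the wrong moduli in general (j017113).  j017273 (class sums + character spectrum,
  DECISIVE): the excess at `k = 2267` is ONE character pair of ORDER 11 with `|B_ψ|²/M = 391, 461, 531` at
  the three scales (Poisson max over 2266 characters ≈ 8); `k = 1091`: a few pairs (orders 545, 1090) at
  `60–95`; `k = 1411`: the REAL `χ_{−1411}`, `L(1/2) = 0.024`, `|B|²/M = 293, 372, 450` (the pole mechanism,
  where it applies); control primes 2269, 1097, 3391, …: `δ_k ≈ 0` but still 2–36 characters above `9M`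
  (exponential law: < 0.5) — heavy tails are universal, the anomalous moduli host an extreme character;
  `k = 3379` (fan₀ argmax at the top scales) has `δ_k ≈ 0`: its excess sits NEAR `a/3379` (twisted sums),
  same family.  PRETENTIOUSNESS CONFIRMED: the order-11 pair mod 2267 carrying `|B_ψ|²/M = 531` is the
  conjugate pair with `Σ_{p<400} Re(λ(p)ψ(p))/p = +1.20` (other pairs `≤ +0.34`): `ψ(p)` is the 11th root
  of unity nearest `−1 = λ(p)` at `p = 2, 3, 11, 17, 37, 41` — a Granville–Soundararajan pretentious
  character sum of `λ`, persistent in `M` by construction.  PART C of j017230 (resonance test `n' ≡ n (mod k)` at `c = 1`, all `k`): no effect beyond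
  noise (M = 2.5·10⁵: family means z ∈ [−0.10, +0.08], rms 0.98–1.03; M = 10⁶ in the evidence file).
  Evidence file NUMERICS-c1.md on the item (`ledger workitem evidence`).
-/

end Summit.Parity.GeneralizedHardyLittlewood.Cruxes.FanDecorrelation.Disproof

end
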